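import Mathlib.NumberTheory.ArithmeticFunction.Moebius
import Mathlib.Analysis.SpecialFunctions.Log.Basic
import HarnessLib

/-!
# Route `PrimeLevelFamEdge`, crux K_A `MomentsBeyondDiagonal` (stmt-Parity-20007), line «petersson_layers» v4, stub `stub_diag`:
# **an elementary tool for L4 of the (P2TAIL) chain: Dirichlet's hyperbola identity (general summand)**

Split off `…DiagRemP2Hyperbola` (the 400-line rule). Plan: `Cruxes/MomentsBeyondDiagonal/Lines/petersson_layers_stub_diag_g12_R02_R22.md`.

* `sum_hyperbola_asym` — for `u² ≤ Z < (u+1)²`: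
  `Σ_{d ≤ Z}Σ_{e ≤ Z/d} F(d,e) = Σ_{d ≤ u}Σ_{e ≤ Z/d} F(d,e) + Σ_{e ≤ u}Σ_{u < d ≤ Z/e} F(d,e)`
  (the tree's `…KernelFormXSq.sum_hyperbola_symm` is the symmetric case).

Def-free; theorems only; elementary. Helper `--supports stmt-Parity-20007`; closes nothing; K_A, K_B and the Parity summit are
NOT proved; nothing about Landau–Siegel zeros.

## References
* H. L. Montgomery, R. C. Vaughan, *Multiplicative Number Theory I*, CUP 2007, §2.1 (the hyperbola method).
  [cite: MontgomeryVaughan2007, §2.1 — derivation]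
-/

open Finset Real

namespace Summit.Parity.GeneralizedHardyLittlewood.Theorems.MomentsBeyondDiagonal.DiagCorner

/-- **Dirichlet's hyperbola identity** (general summand): for `u² ≤ Z < (u+1)²`,
`Σ_{d ≤ Z}Σ_{e ≤ Z/d} F(d,e) = Σ_{d ≤ u}Σ_{e ≤ Z/d} F(d,e) + Σ_{e ≤ u}Σ_{u < d ≤ Z/e} F(d,e)`.
[cite: MontgomeryVaughan2007, §2.1 — derivation] -/
theorem sum_hyperbola_asym (F : ℕ → ℕ → ℝ) {Z u : ℕ} (hu1 : u * u ≤ Z) (hu2 : Z < (u + 1) * (u + 1)) :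
    ∑ d ∈ Icc 1 Z, ∑ e ∈ Icc 1 (Z / d), F d e =
      ∑ d ∈ Icc 1 u, ∑ e ∈ Icc 1 (Z / d), F d e + ∑ e ∈ Icc 1 u, ∑ d ∈ Ioc u (Z / e), F d e := by
  have huZ : u ≤ Z := by nlinarith
  have hlarge : ∀ d, u < d → Z / d ≤ u := by
    intro d hd
    have h1 : Z / d ≤ Z / (u + 1) := Nat.div_le_div_left hd (Nat.succ_pos u)
    have h2 : Z / (u + 1) < u + 1 := (Nat.div_lt_iff_lt_mul (Nat.succ_pos u)).2 hu2
    omega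
  have hsplit : Icc 1 Z = Icc 1 u ∪ Ioc u Z := by
    ext d; simp only [Finset.mem_union, Finset.mem_Icc, Finset.mem_Ioc]; omega
  have hdisj : Disjoint (Icc 1 u) (Ioc u Z) := by
    rw [Finset.disjoint_left]; intro d hd hd'
    simp only [Finset.mem_Icc, Finset.mem_Ioc] at hd hd'; omega
  rw [hsplit, Finset.sum_union hdisj]
  congr 1
  refine Finset.sum_comm' fun d e ↦ ?_
  simp only [Finset.mem_Ioc, Finset.mem_Icc]
  constructor
  · rintro ⟨⟨hud, hdZ⟩, he1, heZ⟩
    have hd0 : 0 < d := by omega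
    have hde : e * d ≤ Z := (Nat.le_div_iff_mul_le hd0).1 heZ
    refine ⟨⟨hud, ?_⟩, he1, heZ.trans (hlarge d hud)⟩
    exact (Nat.le_div_iff_mul_le (by omega)).2 (by rwa [mul_comm] at hde)
  · rintro ⟨⟨hud, hdZe⟩, he1, heu⟩
    have hd0 : 0 < d := by omega
    have hde : d * e ≤ Z := (Nat.le_div_iff_mul_le (by omega)).1 hdZe
    refine ⟨⟨hud, hdZe.trans (Nat.div_le_self Z e)⟩, he1, ?_⟩
    exact (Nat.le_div_iff_mul_le hd0).2 (by rwa [mul_comm] at hde)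

end Summit.Parity.GeneralizedHardyLittlewood.Theorems.MomentsBeyondDiagonal.DiagCorner
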